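import Mathlib
import HarnessLib
import HarnessLib.Audit
import Summits.KontsevichZagierPeriods.Statement
import Literature.NumberTheory.Transcendental.KZProduct
import HarnessLib.Audit.Status.Attr

/-!
Route: SpectatorSlicing

DORMANT since 2026-08-24T07:11:00Z (reconciler: no traction for 6.6 d (last activity item-evidence-added at 2026-08-17T16:47:39Z); parked, not closed — `ledger route dormant route-KontsevichZagierPeriods-SpectatorSlicing --off` to react) — unstaffed, not closed; items shared with open routes are served there. `ledger route dormant <id> --off` reactivates.

# Route SpectatorSlicing — π-cancellation is carrier rigidity: disc-products certified by spectator
moves descend along a unit box inside the disc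

Write [π] ⋆ c := `KZ.of KZ.piRep * c` for the disc-product of a formal combination c
(KZProduct.lean, def wi-04087 now in the tree:
closed unit disc in the two LEADING coordinates, integrand 1 ⊗ f;
`KZ.PiCancellation`/`KZ.PiLocalKernel` are the concrete forms of
stmt-0540/0541 of route AyoubSpecialisation). It suffices to show X = CARRIER RIGIDITY: whenever [π]
⋆ c ∈ KZ.relations, the relation is
already generated by SPECTATOR move instances with respect to coordinates 0, 1 — domain and
integrand additivity (any dimension), changes
of variables Φ with Φ(x)₀ = x₀ and Φ(x)₁ = x₁ on the domain, and Newton–Leibniz moves whose band has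
dimension ≥ 3 (so the coordinate
integrated out, the last one, is never a disc coordinate). Given X, the support lemma
SpectatorDescent (provable now: restrict every
representation to the cylinder over the unit-area rational box B = [−1/2,1/2]² ⊂ disc — a
homomorphism of FormalRep that maps spectator
move instances to move instances and [π] ⋆ c to [B] ⋆ c ∼ c) gives π-cancellation
(`KZ.PiCancellation`, stmt-0540), and with the
recorded conjunct `KZ.PiLocalKernel` (stmt-0541, ≈ Grothendieck-strength, shared, NOT attacked here)
and the two proved assemblies of the
tree, the summit. So the thesis is the PiCancellation half of the π-localisation split, in
normal-form shape: X ⟺ KZ.PiCancellation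
(by SpectatorDescent and DiscIdeal, both provable now; both directions are two-line proofs in the
folder's Sketch.lean); its value is the
FORM — a statement about rewriting certificates — and the isolation of the first essential case
(crux OneMoveRigidity). Card realised:
height-one-is-de-rham-spectator-slicing ((U3) spectator slicing, in box form, and (N4) carrier
rigidity; (U1)/(U2) enter the rationale only).
Lean: `∀ c : Literature.NumberTheory.Transcendental.KZ.FormalRep,
Literature.NumberTheory.Transcendental.KZ.of Literature.NumberTheory.Transcendental.KZ.piRep * c ∈
Literature.NumberTheory.Transcendental.KZ.relations → Literature.NumberTheory.Transcendental.KZ.of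
Literature.NumberTheory.Transcendental.KZ.piRep * c ∈ AddSubgroup.closure
(Literature.NumberTheory.Transcendental.KZ.domainAddRel ∪
Literature.NumberTheory.Transcendental.KZ.integrandAddRel ∪ {c :
Literature.NumberTheory.Transcendental.KZ.FormalRep | ∃ (n : ℕ) (r r' :
Literature.NumberTheory.Transcendental.KZ.IntegralRep n) (Φ : (Fin n → ℝ) → (Fin n → ℝ)) (Φ' : (Fin
n → ℝ) → (Fin n → ℝ) →L[ℝ] (Fin n → ℝ)), Literature.NumberTheory.Transcendental.IsSemialgebraicMapOn
ℚ r.domain Φ ∧ (∀ x ∈ r.domain, HasFDerivWithinAt Φ (Φ' x) r.domain x) ∧ Set.InjOn Φ r.domain ∧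
r'.domain = Φ '' r.domain ∧ (∀ x ∈ r.domain, r.integrand x = r'.integrand (Φ x) * |(Φ' x).det|) ∧ (∀
x ∈ r.domain, ∀ i : Fin n, (i : ℕ) < 2 → Φ x i = x i) ∧ c =
Literature.NumberTheory.Transcendental.KZ.of r - Literature.NumberTheory.Transcendental.KZ.of r'} ∪
{c : Literature.NumberTheory.Transcendental.KZ.FormalRep | ∃ (n : ℕ) (r :
Literature.NumberTheory.Transcendental.KZ.IntegralRep (2 + n + 1)) (r' :
Literature.NumberTheory.Transcendental.KZ.IntegralRep (2 + n)) (a b : (Fin (2 + n) → ℝ) → ℝ) (F :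
(Fin (2 + n + 1) → ℝ) → ℝ), Literature.NumberTheory.Transcendental.IsSemialgebraicFunOn ℚ r.domain F
∧ Literature.NumberTheory.Transcendental.IsSemialgebraicFunOn ℚ r'.domain a ∧
Literature.NumberTheory.Transcendental.IsSemialgebraicFunOn ℚ r'.domain b ∧ (∀ x ∈ r'.domain, a x ≤
b x) ∧ r.domain = {z | (Fin.init z : Fin (2 + n) → ℝ) ∈ r'.domain ∧ a (Fin.init z) ≤ z (Fin.last (2
+ n)) ∧ z (Fin.last (2 + n)) ≤ b (Fin.init z)} ∧ (∀ x ∈ r'.domain, ContinuousOn (fun t : ℝ => F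
(Fin.snoc x t)) (Set.Icc (a x) (b x))) ∧ (∀ x ∈ r'.domain, ∀ t ∈ Set.Ioo (a x) (b x), HasDerivAt
(fun s : ℝ => F (Fin.snoc x s)) (r.integrand (Fin.snoc x t)) t) ∧ (∀ x ∈ r'.domain, r'.integrand x =
F (Fin.snoc x (b x)) - F (Fin.snoc x (a x))) ∧ c = Literature.NumberTheory.Transcendental.KZ.of r -
Literature.NumberTheory.Transcendental.KZ.of r'})`

## Assembly
Pure logic over two PROVED theorems of the tree, checked sorry-free in the folder's Sketch.lean
(`theorem assembly_holds : Assembly`):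
CarrierRigidity followed by SpectatorDescent is `KZ.PiCancellation`; with `KZ.PiLocalKernel`,
`Summit.KontsevichZagierPeriods.AyoubSpecialisation.kzKernelConjecture_of_piLocalKernel_of_piCancellation`
(Theorems/AyoubSpecialisationAssembly.lean,
stmt-0539, proved; instantiated at mul := KZ.FormalRep.mul, p := KZ.of KZ.piRep — definitional match
with `(fun x => of piRep * x)^[N]`)
gives KZKernelConjecture, and
`Summit.KontsevichZagierPeriods.KernelForm.kontsevichZagierPeriods_of_kzKernelConjecture`
(Theorems/KernelFormKernelImpliesStatement.lean, stmt-0197, proved) gives the summit. The Assembly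
item is provable the day it is served (8 lines).

Rationale: WHY THIS LINE. stmt-0540 (π-cancellation: [π] is a non-zero-divisor of FormalRep/relations) is the
transcendence-free half of Conjecture 1 in the
π-localisation split of route AyoubSpecialisation — the calculus-level shadow of the
effective-versus-localised seam P_eff → P_eff[(2πi)⁻¹]
(AyoubRelKZRevisited Rem 1.3; HuberMullerStach2017 §13.1; HuberWustholz2022 App. A, p. 200, records
the motivic form as an open question
and proves it for 1-motives, Thm. 13.5; nothing in print at calculus level, per five grounder notes
on 0540) — and its only
recorded attack idea is 'specialise the disc coordinates at a rational point; changes of variables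
may mix them'. This line makes that
idea a decomposition with three typed parts: (i) the mixing obstruction becomes a NORMAL-FORM
statement on certificates (CarrierRigidity:
certificates of disc-products can be chosen spectator), provably equivalent to 0540
(SpectatorDescent + DiscIdeal), hence unrefutable
short of ¬Conjecture 1 but now in the shape where rewriting / normal-form tools for derivations
apply (interchange and diamond lemmas of
card every-valley-is-a-peak-common-unfolding; Newman's lemma); (ii) the specialisation step becomes
unconditional and tameness-free —
'slice at a generic algebraic point' is replaced by 'restrict to a unit-area rational box inside the
disc': restriction to a sub-cylinder
preserves absolute integrability, commutes with every spectator move instance, and [B] ⋆ c ∼ c by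
two slab moves, so neither the
integrability locus of slices (Comte–Lion–Rolin, Cluckers–Miller doi:10.1093/imrn/rnr133) nor
divisibility in FormalRep/relations is
needed; (iii) the first case where carrier migration can be ESSENTIAL is isolated as a bounded
problem of real semialgebraic measure
theory (OneMoveRigidity: cancel the disc factor across ONE Jacobian change of variables), open to
cylindrical decomposition adapted to Φ
and fibrewise transport arguments (BochnakCosteRoy1998 §2.3, §9.3). Imported areas: rewriting theory
(normal forms of derivations);
semialgebraic / o-minimal fibre integration (the PA-form calculus of Kontsevich–Soibelman
arXiv:math/0001151 App. 8 and HLTV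
doi:10.2140/agt.2011.11.2477 §5 is the published home of 'integrate out a fibre, coefficients stay
semialgebraic'; KontsevichZagier2001
§1.2 is the calculus itself); optimal transport only as vocabulary (a certificate through a mixing Φ
is a coupling of the disc with
itself). What it does that other lines do not: AyoubSpecialisation states 0540 and stops; card
integral-domain-roots-of-identities would
get 0540 from integrality of the KZ period ring (summit-adjacent strength); ScissorsTransport
re-presents the whole calculus; this line
stays inside the four moves, is combinatorial, builds on the proved algebra of KZProductIdeal.lean
(ideal property, reindex
moves, eval_mul'), and produces two provable-now lemmas that every future attack on 0540 can use.
Negatives index: empty at filing.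

RANKED CRUXES. #2 CarrierRigidity (crux) — For every c : KZ.FormalRep: KZ.of KZ.piRep * c ∈
KZ.relations ⇒ KZ.of KZ.piRep * c ∈ AddSubgroup.closure Spec₀₁, where Spec₀₁ = domainAddRel ∪
integrandAddRel ∪ (change-of-variables instances, same side conditions as KZ.changeOfVariablesRel,
with Φ x 0 = x 0 and Φ x 1 = x 1 on r.domain) ∪ (Newton–Leibniz instances, same side conditions as
KZ.newtonLeibnizRel, with band : IntegralRep (2+n+1) over base : IntegralRep (2+n) — indexed so that
disc-products of bands match DEFINITIONALLY, Sketch.lean indexCheck). Card item (N4)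
'CarrierRigidity', typed on move instances (spectator-ness is a property of instances, not of
elements of FormalRep: loops vanish in the abelian group). Equivalent to KZ.PiCancellation given
SpectatorDescent + DiscIdeal (Sketch.lean: piCancellation_of_rigidity_of_descent,
rigidity_of_piCancellation_of_ideal). [difficulty: XL] (why it might fail: Truth-value cannot fail
short of ¬Conjecture 1 (⟺ stmt-0540 given SpectatorDescent + DiscIdeal); what can fail is the proof
shape: an essential carrier migration — disc area split in transcendental proportions inside
non-product pieces — may admit no rewriting to spectator form.) [AyoubRelKZRevisited,
HuberWustholz2022, HuberMullerStach2017, KontsevichZagier2001, CressonViusos2022]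
#3 OneMoveRigidity (crux) — The length-one case of CarrierRigidity. If KZ.of (KZ.piRep.prod r) −
KZ.of (KZ.piRep.prod r′) (r, r′ of one dimension n) is itself ONE change-of-variables instance — a
ℚ-semialgebraic Φ : D × σ → D × σ′, injective, differentiable within, with f(x) = f′(pr Φ(z,x))·|det
Φ′(z,x)|, allowed to mix disc and factor coordinates — then [r] − [r′] ∈ KZ.relations. Among
one-move certificates between disc-products only rule (2) is non-trivial (a 1a/1b/NL instance
between disc-products is spectator verbatim: D×σ = D×σ₁ ∪ D×σ₂ forces σ = σ₁ ∪ σ₂ with null overlap;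
a band D×band is a band over D×base along the same last coordinate), so this is exactly the first
place where carrier migration can be essential. Test-bed (n = 1): in the coordinates (u = |z|², x)
on D×[0,1] the measure-swap H(u,x) = (F(x)/m, F′⁻¹(m u)) is a mixing, volume-compatible,
semialgebraic Φ iff F = ∫f and F′⁻¹ are semialgebraic — and then [r] ∼ [pt, m] ∼ [r′] by two NL
moves anyway: mixing built from primitives is inessential, which is the mechanism a proof should
generalise (semialgebraicity of Φ forces semialgebraic disintegration data). A special case of
KZ.PiCancellation (Sketch.lean: oneMoveRigidity_of_piCancellation, via of_mul_of and mul_sub), hence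
of Conjecture 1. [deps: CarrierRigidity] [difficulty: L] (why it might fail: A Jacobian-twisted Φ
can split the disc's area in transcendental proportions hidden in non-product pieces of D×σ′; box
restriction does not survive a mixing Φ, so [r] ∼ [r′] may need Conjecture 1 in dimension n outright
— no unconditional tool is known.) [CressonViusos2022, BochnakCosteRoy1998, KontsevichZagier2001,
ViuSos2021]
#9 SpectatorDescent (support) — KZ.of KZ.piRep * c ∈ AddSubgroup.closure Spec₀₁ ⇒ c ∈ KZ.relations
(card item (N3), box form; provable now, ≈ 600–900 lines). Plan: ρ_B := FreeAbelianGroup.lift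
sending a representation of dimension ≥ 2 to KZ.of of its restriction (IntegralRep.restrict) to the
cylinder C_B = (|z 0| ≤ 1/2 ∧ |z 1| ≤ 1/2), and dimensions 0, 1 to 0. Each Spec₀₁ generator maps to
a move instance of the same kind or to 0: 1a — (σ₁ ∪ σ₂) ∩ C_B = (σ₁ ∩ C_B) ∪ (σ₂ ∩ C_B), overlap
still null; 1b — same domain; CoV fixing 0,1 — Φ(σ ∩ C_B) = Φ(σ) ∩ C_B, HasFDerivWithinAt.mono,
InjOn.mono, IsSemialgebraicMapOn.mono; NL with band dimension ≥ 3 — (Fin.init z) 0 = z 0 and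
(Fin.init z) 1 = z 1, so the restricted band is the band over the restricted base with the same a,
b, F and the same fibres. Hence ρ_B(closure Spec₀₁) ⊆ relations (AddSubgroup.closure_le). Since B ⊂
piDisc (1/4 + 1/4 ≤ 1) and (piRep.prod r).integrand = 1 ⊗ f (piRep_prod_integrand), ρ_B(KZ.of
KZ.piRep * c) = [B] ⋆ c, and [B] ⋆ [r] − [r] ∈ relations: relabel coordinates so that the box comes
last (IntegralRep.reindex, of_sub_of_reindex_mem_relations — PROVED in KZProductIdeal.lean),
translate by (1/2, 1/2) (a changeOfVariablesRel instance, |det| = 1), then two slab moves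
(KZ.IntegralRep.slab, of_slab_sub_of_mem_newtonLeibnizRel: primitive t · f(init z), the integrand
being constant along the box directions). So c ≡ [B] ⋆ c ∈ relations. No generic point, no
integrability locus, no division by integers: the box has area exactly 1; the cylinder lemmas
isSemialgebraic_cylinder / isSemialgebraicFunOn_cylinder_left of KZProductIdeal.lean supply the
semialgebraicity bookkeeping. [difficulty: provable-now] [KontsevichZagier2001, BochnakCosteRoy1998]
#9 DiscIdeal (support) — c ∈ KZ.relations ⇒ KZ.of KZ.piRep * c ∈ AddSubgroup.closure Spec₀₁ — the
SPECTATOR sharpening of the tree's PROVED ideal lemma piRep_mul_mem_relations (KZProductIdeal.lean):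
the disc-product of every move instance is a spectator move instance, and the proofs
of_mul_mem_relations_of_mem_domainAddRel / _integrandAddRel / _newtonLeibnizRel /
_changeOfVariablesRel (ibid., t := piRep, piRep_leftResolves) already CONSTRUCT exactly these
instances (the block map (y, x) ↦ (y, Φ x) fixes the two leading coordinates,
isSemialgebraicMapOn_blockMap; [π] ⋆ band is a band over piDisc × base in the same last coordinate,
apply_natAdd_last) — what remains is to record membership in Spec₀₁ instead of relations and to run
the closure induction. Shows KZ.PiCancellation ⇒ CarrierRigidity, i.e. the crux is a reformulation
of 0540 and inherits its status (a consequence of Conjecture 1, piCancellation_of_kernel). Provable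
now, ≈ 250 lines on top of KZProductIdeal.lean. [difficulty: provable-now] [KontsevichZagier2001,
BochnakCosteRoy1998]
#9 PiLocalKernel (support) — IMPORTED CONJUNCT — the tree's open statement
`Literature.NumberTheory.Transcendental.KZ.PiLocalKernel` (KZProduct.lean, registered by def
wi-04087 as the concrete form of stmt-0541 of route AyoubSpecialisation, whose ledger signature is
still the interim ∀P-interface; the two agree because the interface P is unique — IntegralRep.ext' —
and is piRep.prod reindexed; when 0541 is restated to this constant the items coincide): every c
with KZ.eval c = 0 has (of piRep * ·)^[N] c ∈ KZ.relations for some N. ≈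
Grothendieck-period-conjecture strength (Ayoub2014 Conj. 7; HuberMullerStach2017 Conj. 12.2.1);
reached by torsor / cohomological transfer (routes Grothendieck, NoriTransfer, AyoubSpecialisation);
NOT attacked by this route and not ranked here — listed because the Assembly needs it. [difficulty:
open-problem] [Ayoub2014, AyoubRelKZRevisited, HuberMullerStach2017, HuberWustholz2022]

TWO-LAYER PLAN. Foreseen, none filed now (D-0019). Under CarrierRigidity, once the common-unfolding
normal form of card every-valley-is-a-peak-common-unfolding
is available as an item (to be SHARED with that card's route if it opens, not re-filed here):
CarrierRigidity ⇐ PeakNormalForm →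
PeakCarrierRigidity → CarrierRigidity, where PeakNormalForm = 'KZ.relations membership of c⁺ − c⁻
(effective) = existence of a common
unfolding R with c⁺ ≼ R ≽ c⁻ by downward Newton–Leibniz and level steps' and PeakCarrierRigidity =
'a peak over ([π] ⋆ c⁺, [π] ⋆ c⁻) can be
re-chosen so that the two disc coordinate pairs of R coincide' (the card's (N4) in its native
language; its descents are then spectator
and SpectatorDescent's box finishes). Under OneMoveRigidity: DimOne (n = 1, solid cylinder D × σ ⊂
ℝ³: classify mixing Φ by CAD; the
measure-swap family is the model) → FibredReduction (a general Φ is, cell by cell, fibred over the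
disc after composing with spectator
instances) → OneMoveRigidity.

KILL CRITERIA. CarrierRigidity and OneMoveRigidity are consequences of Conjecture 1 (S ⇒ stmt-0540 ⇒
CarrierRigidity by DiscIdeal; 0540 ⇒ OneMoveRigidity
by oneMoveRigidity_of_piCancellation), so a refutation of either REFUTES THE SUMMIT: close
`refuted:CarrierRigidity` (resp. OneMoveRigidity), and the witness — an
essential carrier migration, i.e. a π-torsion class in FormalRep/relations — is a proof of stmt-0542
(AyoubNotPiCancellation) and of
route Neg's target; hand it over. A refutation of SpectatorDescent or DiscIdeal can only come from a
misread side
condition of a move under restriction/product (fibre continuity, HasFDerivWithinAt within the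
smaller set, null overlaps): repair by
`route edit --restate` with the corrected side condition — not a kill. stmt-0540 proved elsewhere
(e.g. through card
integral-domain-roots-of-identities) makes CarrierRigidity a corollary (DiscIdeal) and the route is
`superseded`; OneMoveRigidity shown
to be LowDimension-hard (a mixing Φ whose factor pair needs Baker-type input) forces a pivot: drop
it to support and promote the
peak-normal-form split. PiLocalKernel refuted ⇒ ¬S and every positive route closes.

NOT DECOMPOSED YET. Deliberately not typed at open: the D/U/level (common-unfolding) presentation
and its height, in which CarrierRigidity is meant to be
PROVED (owned by card every-valley-is-a-peak-common-unfolding; its interchange lemma is the first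
layer-2 tool); general carriers [ρ] with
eval ρ ≠ 0 in place of the disc (box descent needs a sub-box on which ρ's integrand is constant; for
ρ = [ℝ, 1/(1+s²)] one must slice at
a generic algebraic point τ₀ with 1/(1+τ₀²) = 1/q instead, which needs definability of the
integrability locus of slices of a
semialgebraic family — Comte–Lion–Rolin, Cluckers–Miller doi:10.1093/imrn/rnr133 — and the q-fold
integrand-additivity trick; this is
the card's original (U3) and is kept for tenure); the card's (U2) swap densities (explicit
semialgebraic densities with two
transcendental Fubini shadows in different coordinates — for the disc simply K(z₀,z₁,z₂) =
1_D(z₀,z₁)·1_D(z₁,z₂)/(2√(1−z₁²)), integrable,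
with fibre primitives (z₂ + w)/(2w), w = √(1−z₁²)) — recorded as the reason Spec₀₁ lives on move
INSTANCES and as the source of
inessential migrations, not filed (a loop at [π] is 0 in FormalRep); the card's (U1) 'height one =
closed semialgebraic form' (a
viewpoint, no separate claim); the dimension ≤ 1 sector of 0540 (pairs with LowDimension stmt-0405
and Huber–Wüstholz's 1-period
theorem); effective bounds (length/degree of the spectator certificate against the given one); the
bridge between these concrete
statements and the interim ∀P-interface signatures of stmt-0540/0541 (IntegralRep.ext' + a reindex
along Fin (n+2) ≃ Fin (2+n), ≈ 60
lines) until those items are restated over KZProduct.lean.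

CHEAPEST FALSIFIER. OneMoveRigidity at n = 1, by hand or as a small CAD computation on the solid
cylinder D × [0,1] ⊂ ℝ³ (coordinates u = |z|², angle, x).
Known inessential cases: (a) core/annulus exchange (D_{1/2}×[0,1] → D×[0,1/4], Ann×[0,1] →
D×[1/4,1]) — rational area ratios 1/4, 3/4, so
[r] ∼ [r′] by 1b + two 1-dim CoVs; (b) the measure swap H(u,x) = (F(x)/m, F′⁻¹(m u)) (e.g. f = 3x,
f′ = 1 + x: H = (x², −1 + √(1+3u)))
is genuinely mixing but semialgebraic only when F, F′⁻¹ are, and then [r] ∼ [pt, m] ∼ [r′] by two NL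
moves. THE CHECK: exhibit a
mixing semialgebraic Φ between D×σ and D×σ′ whose fibre data are NOT built from semialgebraic
primitives of f, f′ (e.g. f = 1/(x+1) on
[0,1], value log 2, against a rational f′ of value log 2 not related to f by a 1-dim CoV), or show
by cylindrical decomposition that
none exists. The former makes OneMoveRigidity LowDimension-hard (demote it, pivot to the peak
split); the latter proves it for n = 1 and
names the induction. For SpectatorDescent/DiscIdeal: re-derive ρ_B and the disc-product on the four
move families against
KZCalculus.lean's exact side conditions — done on paper this session, no gap; a refuter should redo
the NL fibre-continuity clause.

NUMBERS. Items at open: 6 (2 cruxes, 3 support, 1 assembly); Sketch.lean rc 0, 0 sorries (lean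
check, 2026-08-15, concrete-product form).
Box B = [−1/2,1/2]²: area 1, B ⊂ piDisc because 1/4 + 1/4 ≤ 1. The disc-product raises dimension by
2 (piRep.prod r : IntegralRep (2 + n));
Spec₀₁ Newton–Leibniz bands have dimension ≥ 3; Spec₀₁ changes of variables fix coordinates 0 and 1
pointwise. Ledger/tree status
(2026-08-15): stmt-0540 open (crux rank 2 of AyoubSpecialisation, checked; concrete form
KZ.PiCancellation in KZProduct.lean),
stmt-0541 open (KZ.PiLocalKernel), stmt-0539 and stmt-0197 proved, def wi-04087 LANDED
(KZProduct.lean + KZProductIdeal.lean: ideal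
property, reindex moves, eval_mul', piCancellation_iff_injective all proved). Printed status of the
motivic shadow (HuberWustholz2022
App. A, PDF p. 200): injectivity of P̃(MM^eff_Nori) → P̃(MM_Nori) = P^eff[1/2πi] is 'an open
question', a consequence of the period
conjecture (Prop. 7.17), PROVED for 1-motives (Thm. 13.5). Area bookkeeping used in the falsifier:
area D_{1/2} / area D = 1/4;
area Ann(1,√2) = area D = π (so [Ann] ⋆ c ∼ [π] ⋆ c by the √2-dilation and 1a — two different
carriers of π act identically).

DEFINITION REQUESTS. None. All six statements elaborate over existing declarations: KZCalculus.lean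
(IntegralRep, FormalRep, of, eval, the four move sets,
relations), KZProduct.lean (piRep, IntegralRep.prod, the Mul instance, PiLocalKernel — def wi-04087,
landed), SemialgebraicMaps.lean
(IsSemialgebraicMapOn/FunOn), Mathlib (AddSubgroup.closure, HasFDerivWithinAt,
ContinuousLinearMap.det). Housekeeping note for the
AyoubSpecialisation tenure planner: restating stmt-0540/0541 to the landed constants
KZ.PiCancellation / KZ.PiLocalKernel merges this
route's PiLocalKernel item with 0541.

Novelty: Searches (2026-08-15, 11:30–12:15Z): `lit frontier KontsevichZagierPeriods --since 2020` (30 rows: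
Kummer-surface GPC, odd zeta values,
motivic coactions — none on effective-period regularity or normal forms of derivations); `lit
bridges KontsevichZagierPeriods --cross any`
(30, none relevant); `lit search --hybrid "effective periods localization inverting 2πi injective
Kontsevich formal period algebra"`
(8 docs: Müller-Stach arXiv:1407.2388 p. 4; Huber–Wüstholz 2022, Transcendence and Linear Relations
of 1-Periods, doi:10.1017/9781009019729
— `lit read … --grep` over 267 pp., then PDF p. 200 read: App. A states verbatim that injectivity of
P̃(MM^eff_Nori) → P̃(MM_Nori) =
P^eff[1/2πi] 'is also an open question', a consequence of the period conjecture by Prop. 7.17,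
deduced for 1-motives in Thm. 13.5 — the
printed status of the motivic shadow of π-cancellation); `lit search --hybrid "restriction of a
relation certificate to a fibre product with a disc Fubini cancellation"` (8,
irrelevant); `lit search --source zbmath "Kontsevich-Zagier periods conjecture rules"` (2: Fresán
arXiv:2210.03407, Viu-Sos
arXiv:1509.01097); `lit galaxy search "Kontsevich-Zagier period conjecture effective periods" --star
all` (galaxyd queue > 90 s this
hour, no rows; arXiv/OpenAlex cascade HTTP 429 — logged in NOTES.md); the ledger record of stmt-0540
(five grounder notes + reground
2026-08-13/14 with pages checked: AyoubRelKZRevisited p. 2 Rem 1.3, HMS 2015 draft Part III Ch. 12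
pp. 38–45, Huber arX  [refs: 10.1017/9781009019729, 10.2140/agt.2011.11.2477, 1407.2388, 2210.03407, 1509.01097, 1811.06268, 1105.0865, math/0001151, doi:10.1017/9781009019729, doi:10.2140/agt.2011.11.2477, KontsevichZagier2001, Kontsevich1999, HuberWustholz2022, HuberMullerStach2017, CressonViusos2022]

Barriers (technique_class: spectator-slicing, certificate-normal-form, box-descent): - technique_class: spectator-slicing, certificate-normal-form, box-descent
- Literature.Barriers.KontsevichZagierPeriods.noSemialgebraicPrimitive_inv_sub_two: evaded — no
coordinate is ever integrated out by computing a primitive: the two box coordinates are descended by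
slab moves with the LINEAR primitive t · f (the integrand is constant along the box directions
because the carrier is [disc, 1] and B ⊂ disc), and Spec₀₁ forbids Newton–Leibniz along the carrier
coordinates; for non-constant carriers the barrier returns verbatim (arctan on every s-interval for
[ℝ, 1/(1+s²)]), which is exactly why the route is stated for the disc of stmt-0540 and general
carriers are deferred to generic slicing (Not decomposed yet).
- Literature.Barriers.KontsevichZagierPeriods.kzConjecture_implies_oddZetaAlgIndep: not engaged —
CarrierRigidity and OneMoveRigidity are consequences of Conjecture 1 strictly below it
(transcendence-free statements about ℚ-semialgebraic data; they assert no period identity and no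
irrationality); the summit is reached only together with PiLocalKernel, which carries the full
strength and is not attacked here. The bet is on form, not strength.
- Literature.Barriers.KontsevichZagierPeriods.kzConjecture_implies_twoPiI_log_algIndep: same —
nothing is proved about 2πi or log; [π] enters as a formal generator whose REGULARITY, not
transcendence, is at stake (π ≠ 0 is the only fact about π the soundness direction uses).
- Literature.Barriers.KontsevichZagierPeriods.kzConje

Novelty grade: variant — ROUTE REVIEW (refuter rreview-9955905d, 2026-08-15). 6/6 decls elaborate (probe rc0); 0 refuted, 0 vacuous. PROVED and attached (SS_Assembly.lean rc0, 0 sorries, whitelist axioms): Assembly 5245 (8 lines), OneMoveRigidity ⇐ KZ.PiCancellation, CR+SD ⇒ PiCancellation, PiCancellation+DiscIdeal ⇒ CR. Sp (refuter refuter-rreview-route-ValiantsHypothesis-9955905d-0, 2026-08-15T14:00:43Z; prior: route-KontsevichZagierPeriods-AyoubSpecialisation stmt-0540 (KZ.PiCancellation) / stmt-0541 (KZ.PiLocalKernel); KontsevichZagier2001 §1.2, §4.1; HuberWustholz2022 App. A p.200; HuberMullerStach2017 §13.1; Literature.NumberTheory.Transcendental.KZProductIdeal (piRep_mul_mem_r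elations))

History (route lifecycle, newest last):
- 2026-08-16T16:41:15Z · AUTO-CRUX (backfill): PiLocalKernel — hypotheses of the deciding theorem that nothing in the route derives are cruxes (operator:999:1813213)
- 2026-08-24T07:11:00Z · DORMANT — reconciler: no traction for 6.6 d (last activity item-evidence-added at 2026-08-17T16:47:39Z); parked, not closed — `ledger route dormant route-KontsevichZagier (operator:999:4094957)

sub-problem: KontsevichZagierPeriods · status: dormant · opened planner-plancard-KontsevichZagierPeriods-Kont-a39dcb05-0 2026-08-15T11:40:30Z · rev 1 · ledger route-KontsevichZagierPeriods-SpectatorSlicing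
GENERATED by the gate from the ledger (D-0016/17). Provers cite these decls: `theorem foo : Summit.KontsevichZagierPeriods.KontsevichZagierPeriods.Theses.SpectatorSlicing.<Decl> := …` in Summits/KontsevichZagierPeriods/KontsevichZagierPeriods/Theorems/<Name>.lean.
-/

namespace Summit.KontsevichZagierPeriods.KontsevichZagierPeriods.Theses.SpectatorSlicing

open scoped BigOperators Topology Manifold Classical MeasureTheory ProbabilityTheory Matrix InnerProductSpace ComplexConjugate ContinuousMap
open Filter Set Function TopologicalSpace MeasureTheory

attribute [summit_statement] _root_.KontsevichZagierPeriods

open Literature Periods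

/-- item stmt-KontsevichZagierPeriods-5240 · crux · rank 2 · open · by planner
why it might fail: Truth-value cannot fail short of ¬Conjecture 1 (⟺ stmt-0540 given SpectatorDescent + DiscIdeal); what can fail is the proof shape: an essential carrier migration — disc area split in transcendental proportions inside non-product pieces — may admit no rewriting to spectator form.
sources: AyoubRelKZRevisited, HuberWustholz2022, HuberMullerStach2017, KontsevichZagier2001, CressonViusos2022
[crux] For every c : KZ.FormalRep: KZ.of KZ.piRep * c ∈ KZ.relations ⇒ KZ.of KZ.piRep * c ∈
AddSubgroup.closure Spec₀₁, where Spec₀₁ = domainAddRel ∪ integrandAddRel ∪ (change-of-variables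
instances, same side conditions as KZ.changeOfVariablesRel, with Φ x 0 = x 0 and Φ x 1 = x 1 on
r.domain) ∪ (Newton–Leibniz instances, same side conditions as KZ.newtonLeibnizRel, with band :
IntegralRep (2+n+1) over base : IntegralRep (2+n) — indexed so that disc-products of bands match
DEFINITIONALLY, Sketch.lean indexCheck). Card item (N4) 'CarrierRigidity', typed on move instances
(spectator-ness is a property of instances, not of elements of FormalRep: loops vanish in the
abelian group). Equivalent to KZ.PiCancellation given SpectatorDescent + DiscIdeal (Sketch.lean:
piCancellation_of_rigidity_of_descent, rigidity_of_piCancellation_of_ideal). [difficulty: XL] -/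
@[route_item "route-KontsevichZagierPeriods-SpectatorSlicing", crux]
def CarrierRigidity : Prop :=
  ∀ c : Literature.NumberTheory.Transcendental.KZ.FormalRep, Literature.NumberTheory.Transcendental.KZ.of Literature.NumberTheory.Transcendental.KZ.piRep * c ∈ Literature.NumberTheory.Transcendental.KZ.relations → Literature.NumberTheory.Transcendental.KZ.of Literature.NumberTheory.Transcendental.KZ.piRep * c ∈ AddSubgroup.closure (Literature.NumberTheory.Transcendental.KZ.domainAddRel ∪ Literature.NumberTheory.Transcendental.KZ.integrandAddRel ∪ {c : Literature.NumberTheory.Transcendental.KZ.FormalRep | ∃ (n : ℕ) (r r' : Literature.NumberTheory.Transcendental.KZ.IntegralRep n) (Φ : (Fin n → ℝ) → (Fin n → ℝ)) (Φ' : (Fin n → ℝ) → (Fin n → ℝ) →L[ℝ] (Fin n → ℝ)), Literature.NumberTheory.Transcendental.IsSemialgebraicMapOn ℚ r.domain Φ ∧ (∀ x ∈ r.domain, HasFDerivWithinAt Φ (Φ' x) r.domain x) ∧ Set.InjOn Φ r.domain ∧ r'.domain = Φ '' r.domain ∧ (∀ x ∈ r.domain, r.integrand x = r'.integrand (Φ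 x) * |(Φ' x).det|) ∧ (∀ x ∈ r.domain, ∀ i : Fin n, (i : ℕ) < 2 → Φ x i = x i) ∧ c = Literature.NumberTheory.Transcendental.KZ.of r - Literature.NumberTheory.Transcendental.KZ.of r'} ∪ {c : Literature.NumberTheory.Transcendental.KZ.FormalRep | ∃ (n : ℕ) (r : Literature.NumberTheory.Transcendental.KZ.IntegralRep (2 + n + 1)) (r' : Literature.NumberTheory.Transcendental.KZ.IntegralRep (2 + n)) (a b : (Fin (2 + n) → ℝ) → ℝ) (F : (Fin (2 + n + 1) → ℝ) → ℝ), Literature.NumberTheory.Transcendental.IsSemialgebraicFunOn ℚ r.domain F ∧ Literature.NumberTheory.Transcendental.IsSemialgebraicFunOn ℚ r'.domain a ∧ Literature.NumberTheory.Transcendental.IsSemialgebraicFunOn ℚ r'.domain b ∧ (∀ x ∈ r'.domain, a x ≤ b x) ∧ r.domain = {z | (Fin.init z : Fin (2 + n) → ℝ) ∈ r'.domain ∧ a (Fin.init z) ≤ z (Fin.last (2 + n)) ∧ z (Fin.last (2 + n)) ≤ b (Fin.init z)} ∧ (∀ x ∈ r'.domain, ContinuousOn (fun t : ℝ => F (Fin.snoc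 x t)) (Set.Icc (a x) (b x))) ∧ (∀ x ∈ r'.domain, ∀ t ∈ Set.Ioo (a x) (b x), HasDerivAt (fun s : ℝ => F (Fin.snoc x s)) (r.integrand (Fin.snoc x t)) t) ∧ (∀ x ∈ r'.domain, r'.integrand x = F (Fin.snoc x (b x)) - F (Fin.snoc x (a x))) ∧ c = Literature.NumberTheory.Transcendental.KZ.of r - Literature.NumberTheory.Transcendental.KZ.of r'})

/-- item stmt-KontsevichZagierPeriods-5241 · crux · rank 3 · open · by planner
why it might fail: A Jacobian-twisted Φ can split the disc's area in transcendental proportions hidden in non-product pieces of D×σ′; box restriction does not survive a mixing Φ, so [r] ∼ [r′] may need Conjecture 1 in dimension n outright — no unconditional tool is known.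
sources: CressonViusos2022, BochnakCosteRoy1998, KontsevichZagier2001, ViuSos2021
[crux] The length-one case of CarrierRigidity. If KZ.of (KZ.piRep.prod r) − KZ.of (KZ.piRep.prod r′)
(r, r′ of one dimension n) is itself ONE change-of-variables instance — a ℚ-semialgebraic Φ : D × σ
→ D × σ′, injective, differentiable within, with f(x) = f′(pr Φ(z,x))·|det Φ′(z,x)|, allowed to mix
disc and factor coordinates — then [r] − [r′] ∈ KZ.relations. Among one-move certificates between
disc-products only rule (2) is non-trivial (a 1a/1b/NL instance between disc-products is spectator
verbatim: D×σ = D×σ₁ ∪ D×σ₂ forces σ = σ₁ ∪ σ₂ with null overlap; a band D×band is a band over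
D×base along the same last coordinate), so this is exactly the first place where carrier migration
can be essential. Test-bed (n = 1): in the coordinates (u = |z|², x) on D×[0,1] the measure-swap
H(u,x) = (F(x)/m, F′⁻¹(m u)) is a mixing, volume-compatible, semialgebraic Φ iff F = ∫f and F′⁻¹ are
semialgebraic — and then [r] ∼ [pt, m] ∼ [r′] by two NL moves anyway: mixing built from primitives
is inessential, which is the mechanism a proof should generalise (semialgebraicity of Φ forces
semialgebraic disintegration data). A special case of KZ.PiCancellation (Sketch.lean:
oneMoveRigidity_of_piCancellat -/
@[route_item "route-KontsevichZagierPeriods-SpectatorSlicing"]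
def OneMoveRigidity : Prop :=
  ∀ ⦃n : ℕ⦄ (r r' : Literature.NumberTheory.Transcendental.KZ.IntegralRep n), Literature.NumberTheory.Transcendental.KZ.of (Literature.NumberTheory.Transcendental.KZ.piRep.prod r) - Literature.NumberTheory.Transcendental.KZ.of (Literature.NumberTheory.Transcendental.KZ.piRep.prod r') ∈ Literature.NumberTheory.Transcendental.KZ.changeOfVariablesRel → Literature.NumberTheory.Transcendental.KZ.of r - Literature.NumberTheory.Transcendental.KZ.of r' ∈ Literature.NumberTheory.Transcendental.KZ.relations

/-- item stmt-KontsevichZagierPeriods-5244 · crux (kind.auto-crux: conjecture-grade) · rank 9 · open · by planner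
why it might fail: auto-crux — summit-strength (notes:refuter-rreview-route-ValiantsHypothesis-9955905): the deciding theorem assumes it and nothing in the route derives it, so it is a bet, not glue
sources: Ayoub2014, AyoubRelKZRevisited, HuberMullerStach2017, HuberWustholz2022
[support] IMPORTED CONJUNCT — the tree's open statement
`Literature.NumberTheory.Transcendental.KZ.PiLocalKernel` (KZProduct.lean, registered by def
wi-04087 as the concrete form of stmt-0541 of route AyoubSpecialisation, whose ledger signature is
still the interim ∀P-interface; the two agree because the interface P is unique — IntegralRep.ext' —
and is piRep.prod reindexed; when 0541 is restated to this constant the items coincide): every c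
with KZ.eval c = 0 has (of piRep * ·)^[N] c ∈ KZ.relations for some N. ≈
Grothendieck-period-conjecture strength (Ayoub2014 Conj. 7; HuberMullerStach2017 Conj. 12.2.1);
reached by torsor / cohomological transfer (routes Grothendieck, NoriTransfer, AyoubSpecialisation);
NOT attacked by this route and not ranked here — listed because the Assembly needs it. [difficulty:
open-problem] -/
@[route_item "route-KontsevichZagierPeriods-SpectatorSlicing", crux]
def PiLocalKernel : Prop :=
  ∀ c : Literature.NumberTheory.Transcendental.KZ.FormalRep, Literature.NumberTheory.Transcendental.KZ.eval c = 0 → ∃ N : ℕ, (fun x => Literature.NumberTheory.Transcendental.KZ.of Literature.NumberTheory.Transcendental.KZ.piRep * x)^[N] c ∈ Literature.NumberTheory.Transcendental.KZ.relations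

/-- item stmt-KontsevichZagierPeriods-5242 · support · rank 9 · open · by planner
sources: KontsevichZagier2001, BochnakCosteRoy1998
[support] KZ.of KZ.piRep * c ∈ AddSubgroup.closure Spec₀₁ ⇒ c ∈ KZ.relations (card item (N3), box
form; provable now, ≈ 600–900 lines). Plan: ρ_B := FreeAbelianGroup.lift sending a representation of
dimension ≥ 2 to KZ.of of its restriction (IntegralRep.restrict) to the cylinder C_B = (|z 0| ≤ 1/2
∧ |z 1| ≤ 1/2), and dimensions 0, 1 to 0. Each Spec₀₁ generator maps to a move instance of the same
kind or to 0: 1a — (σ₁ ∪ σ₂) ∩ C_B = (σ₁ ∩ C_B) ∪ (σ₂ ∩ C_B), overlap still null; 1b — same domain;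
CoV fixing 0,1 — Φ(σ ∩ C_B) = Φ(σ) ∩ C_B, HasFDerivWithinAt.mono, InjOn.mono,
IsSemialgebraicMapOn.mono; NL with band dimension ≥ 3 — (Fin.init z) 0 = z 0 and (Fin.init z) 1 = z
1, so the restricted band is the band over the restricted base with the same a, b, F and the same
fibres. Hence ρ_B(closure Spec₀₁) ⊆ relations (AddSubgroup.closure_le). Since B ⊂ piDisc (1/4 + 1/4
≤ 1) and (piRep.prod r).integrand = 1 ⊗ f (piRep_prod_integrand), ρ_B(KZ.of KZ.piRep * c) = [B] ⋆ c,
and [B] ⋆ [r] − [r] ∈ relations: relabel coordinates so that the box comes last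
(IntegralRep.reindex, of_sub_of_reindex_mem_relations — PROVED in KZProductIdeal.lean), translate by
(1/2, 1/2) (a changeOfVariablesRel instance -/
@[route_item "route-KontsevichZagierPeriods-SpectatorSlicing", crux]
def SpectatorDescent : Prop :=
  ∀ c : Literature.NumberTheory.Transcendental.KZ.FormalRep, Literature.NumberTheory.Transcendental.KZ.of Literature.NumberTheory.Transcendental.KZ.piRep * c ∈ AddSubgroup.closure (Literature.NumberTheory.Transcendental.KZ.domainAddRel ∪ Literature.NumberTheory.Transcendental.KZ.integrandAddRel ∪ {c : Literature.NumberTheory.Transcendental.KZ.FormalRep | ∃ (n : ℕ) (r r' : Literature.NumberTheory.Transcendental.KZ.IntegralRep n) (Φ : (Fin n → ℝ) → (Fin n → ℝ)) (Φ' : (Fin n → ℝ) → (Fin n → ℝ) →L[ℝ] (Fin n → ℝ)), Literature.NumberTheory.Transcendental.IsSemialgebraicMapOn ℚ r.domain Φ ∧ (∀ x ∈ r.domain, HasFDerivWithinAt Φ (Φ' x) r.domain x) ∧ Set.InjOn Φ r.domain ∧ r'.domain = Φ '' r.domain ∧ (∀ x ∈ r.domain, r.integrand x = r'.integrand (Φ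 x) * |(Φ' x).det|) ∧ (∀ x ∈ r.domain, ∀ i : Fin n, (i : ℕ) < 2 → Φ x i = x i) ∧ c = Literature.NumberTheory.Transcendental.KZ.of r - Literature.NumberTheory.Transcendental.KZ.of r'} ∪ {c : Literature.NumberTheory.Transcendental.KZ.FormalRep | ∃ (n : ℕ) (r : Literature.NumberTheory.Transcendental.KZ.IntegralRep (2 + n + 1)) (r' : Literature.NumberTheory.Transcendental.KZ.IntegralRep (2 + n)) (a b : (Fin (2 + n) → ℝ) → ℝ) (F : (Fin (2 + n + 1) → ℝ) → ℝ), Literature.NumberTheory.Transcendental.IsSemialgebraicFunOn ℚ r.domain F ∧ Literature.NumberTheory.Transcendental.IsSemialgebraicFunOn ℚ r'.domain a ∧ Literature.NumberTheory.Transcendental.IsSemialgebraicFunOn ℚ r'.domain b ∧ (∀ x ∈ r'.domain, a x ≤ b x) ∧ r.domain = {z | (Fin.init z : Fin (2 + n) → ℝ) ∈ r'.domain ∧ a (Fin.init z) ≤ z (Fin.last (2 + n)) ∧ z (Fin.last (2 + n)) ≤ b (Fin.init z)} ∧ (∀ x ∈ r'.domain, ContinuousOn (fun t : ℝ => F (Fin.snoc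 x t)) (Set.Icc (a x) (b x))) ∧ (∀ x ∈ r'.domain, ∀ t ∈ Set.Ioo (a x) (b x), HasDerivAt (fun s : ℝ => F (Fin.snoc x s)) (r.integrand (Fin.snoc x t)) t) ∧ (∀ x ∈ r'.domain, r'.integrand x = F (Fin.snoc x (b x)) - F (Fin.snoc x (a x))) ∧ c = Literature.NumberTheory.Transcendental.KZ.of r - Literature.NumberTheory.Transcendental.KZ.of r'}) → c ∈ Literature.NumberTheory.Transcendental.KZ.relations

/-- item stmt-KontsevichZagierPeriods-5243 · support · rank 9 · open · by planner
sources: KontsevichZagier2001, BochnakCosteRoy1998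
[support] c ∈ KZ.relations ⇒ KZ.of KZ.piRep * c ∈ AddSubgroup.closure Spec₀₁ — the SPECTATOR
sharpening of the tree's PROVED ideal lemma piRep_mul_mem_relations (KZProductIdeal.lean): the
disc-product of every move instance is a spectator move instance, and the proofs
of_mul_mem_relations_of_mem_domainAddRel / _integrandAddRel / _newtonLeibnizRel /
_changeOfVariablesRel (ibid., t := piRep, piRep_leftResolves) already CONSTRUCT exactly these
instances (the block map (y, x) ↦ (y, Φ x) fixes the two leading coordinates,
isSemialgebraicMapOn_blockMap; [π] ⋆ band is a band over piDisc × base in the same last coordinate,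
apply_natAdd_last) — what remains is to record membership in Spec₀₁ instead of relations and to run
the closure induction. Shows KZ.PiCancellation ⇒ CarrierRigidity, i.e. the crux is a reformulation
of 0540 and inherits its status (a consequence of Conjecture 1, piCancellation_of_kernel). Provable
now, ≈ 250 lines on top of KZProductIdeal.lean. [difficulty: provable-now] -/
@[route_item "route-KontsevichZagierPeriods-SpectatorSlicing"]
def DiscIdeal : Prop :=
  ∀ c : Literature.NumberTheory.Transcendental.KZ.FormalRep, c ∈ Literature.NumberTheory.Transcendental.KZ.relations → Literature.NumberTheory.Transcendental.KZ.of Literature.NumberTheory.Transcendental.KZ.piRep * c ∈ AddSubgroup.closure (Literature.NumberTheory.Transcendental.KZ.domainAddRel ∪ Literature.NumberTheory.Transcendental.KZ.integrandAddRel ∪ {c : Literature.NumberTheory.Transcendental.KZ.FormalRep | ∃ (n : ℕ) (r r' : Literature.NumberTheory.Transcendental.KZ.IntegralRep n) (Φ : (Fin n → ℝ) → (Fin n → ℝ)) (Φ' : (Fin n → ℝ) → (Fin n → ℝ) →L[ℝ] (Fin n → ℝ)), Literature.NumberTheory.Transcendental.IsSemialgebraicMapOn ℚ r.domain Φ ∧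 (∀ x ∈ r.domain, HasFDerivWithinAt Φ (Φ' x) r.domain x) ∧ Set.InjOn Φ r.domain ∧ r'.domain = Φ '' r.domain ∧ (∀ x ∈ r.domain, r.integrand x = r'.integrand (Φ x) * |(Φ' x).det|) ∧ (∀ x ∈ r.domain, ∀ i : Fin n, (i : ℕ) < 2 → Φ x i = x i) ∧ c = Literature.NumberTheory.Transcendental.KZ.of r - Literature.NumberTheory.Transcendental.KZ.of r'} ∪ {c : Literature.NumberTheory.Transcendental.KZ.FormalRep | ∃ (n : ℕ) (r : Literature.NumberTheory.Transcendental.KZ.IntegralRep (2 + n + 1)) (r' : Literature.NumberTheory.Transcendental.KZ.IntegralRep (2 + n)) (a b : (Fin (2 + n) → ℝ) → ℝ) (F : (Fin (2 + n + 1) → ℝ) → ℝ), Literature.NumberTheory.Transcendental.IsSemialgebraicFunOn ℚ r.domain F ∧ Literature.NumberTheory.Transcendental.IsSemialgebraicFunOn ℚ r'.domain a ∧ Literature.NumberTheory.Transcendental.IsSemialgebraicFunOn ℚ r'.domain b ∧ (∀ x ∈ r'.domain, a x ≤ b x) ∧ r.domain = {z | (Fin.init z : Fin (2 + n) → ℝ)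 ∈ r'.domain ∧ a (Fin.init z) ≤ z (Fin.last (2 + n)) ∧ z (Fin.last (2 + n)) ≤ b (Fin.init z)} ∧ (∀ x ∈ r'.domain, ContinuousOn (fun t : ℝ => F (Fin.snoc x t)) (Set.Icc (a x) (b x))) ∧ (∀ x ∈ r'.domain, ∀ t ∈ Set.Ioo (a x) (b x), HasDerivAt (fun s : ℝ => F (Fin.snoc x s)) (r.integrand (Fin.snoc x t)) t) ∧ (∀ x ∈ r'.domain, r'.integrand x = F (Fin.snoc x (b x)) - F (Fin.snoc x (a x))) ∧ c = Literature.NumberTheory.Transcendental.KZ.of r - Literature.NumberTheory.Transcendental.KZ.of r'})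

/-- item stmt-KontsevichZagierPeriods-5245 · assembly · rank 1 · closed · proved by Summit.KontsevichZagierPeriods.SpectatorSlicing.assembly_proof @ cf623baf9cf4 (prover) · by planner
sources: KontsevichZagier2001, HuberMullerStach2017
[assembly] CarrierRigidity → SpectatorDescent → PiLocalKernel → KontsevichZagierPeriods
(π-cancellation from the first two, then the proved π-localisation assembly stmt-0539 and
kernel-implies-statement stmt-0197). -/
@[route_item "route-KontsevichZagierPeriods-SpectatorSlicing"]
def Assembly : Prop :=
  CarrierRigidity → SpectatorDescent → PiLocalKernel → KontsevichZagierPeriods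

/-! D-0027 §2.1 — DECIDING THEOREM (planner-authored via `route open/edit --closes-file`; by planner-rbadge-KontsevichZagierPeriods-Spectat-15d66b52-g2-0 2026-08-15T16:10:06Z):
its hypotheses are this route's items and its conclusion the sub-problem Statement (glue_lint), and it elaborates with this file. -/

@[closes "route-KontsevichZagierPeriods-SpectatorSlicing"] theorem closes (hCR : CarrierRigidity) (hSD : SpectatorDescent) (hPL : PiLocalKernel) :
    KontsevichZagierPeriods := by
  -- π-cancellation: a spectator certificate of [π] ⋆ c descends along the unit box to a certificate of c
  have hPC : ∀ c : Literature.NumberTheory.Transcendental.KZ.FormalRep,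
      Literature.NumberTheory.Transcendental.KZ.of Literature.NumberTheory.Transcendental.KZ.piRep * c
        ∈ Literature.NumberTheory.Transcendental.KZ.relations →
      c ∈ Literature.NumberTheory.Transcendental.KZ.relations :=
    fun c hc => hSD c (hCR c hc)
  -- peel the [π]-powers of the π-local kernel one at a time (stmt-0539, inlined)
  have key : ∀ (M : ℕ) (c : Literature.NumberTheory.Transcendental.KZ.FormalRep),
      (fun x => Literature.NumberTheory.Transcendental.KZ.of Literature.NumberTheory.Transcendental.KZ.piRep * x)^[M] c
        ∈ Literature.NumberTheory.Transcendental.KZ.relations →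
      c ∈ Literature.NumberTheory.Transcendental.KZ.relations := by
    intro M
    induction M with
    | zero => intro c h; simpa using h
    | succ M ih =>
        intro c h
        rw [Function.iterate_succ_apply'] at h
        exact ih c (hPC _ h)
  -- kernel form ⇒ the KZ-literal statement (stmt-0197, inlined)
  intro n m r r' _ _ hv
  have h0 : Literature.NumberTheory.Transcendental.KZ.eval
      (Literature.NumberTheory.Transcendental.KZ.of r - Literature.NumberTheory.Transcendental.KZ.of r') = 0 := by
    simp [Literature.NumberTheory.Transcendental.KZ.eval_of, hv]
  obtain ⟨N, hN⟩ := hPL _ h0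
  exact key N _ hN

end Summit.KontsevichZagierPeriods.KontsevichZagierPeriods.Theses.SpectatorSlicing
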